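import Summits.HodgeConjecture.HodgeConjecture.Theorems.PadicSemiregularLiftHodgeFermatVarietiesGeneralTwinLevel
import Summits.HodgeConjecture.HodgeConjecture.Theorems.PadicSemiregularLiftHodgeFermatVarietiesPQTwinCounting

/-!
# GP without the twin exclusion, IV — the case `n = 1` (level exactly `p r`): the refined fibre count in `T`-language (`even_or_fibre_twoPrime_one`)

Part 4 of 9 (Sketch Part D, ll. 620–945): **`even_or_fibre_twoPrime_one`** — the counting lemmas `two_mul_card_add_ne_zero_ge`,
`false_of_both_ne_zero` (if `G ≢ 0 ≢ H` then `2·#supp + 3AB ≥ 2A(p-1) + 2B(q-1)`, impossible for `q ≥ 11` under `#supp ≤ 2(p+1)`) are the SAME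
declarations as in `Theorems/PadicSemiregularLiftHodgeFermatVarietiesPQTwinCounting` (namespace `…PQTwin`, landed first) and are imported from
there instead of being restated (gate dedup, 2026-08-28; the only deviation of this Part from the kit file e55224ca61b16e99): (L-twin) at level exactly `p r` (`5 ≤ p < r`, `11 ≤ r`) — `T` even, or a full fibre —
memo ROUTE-P1AF-ADD2's counting (`PQTwin.structure_units_pq'`) in `T`-language.

PROVENANCE. Cell hodge-nonav (HUMAN RULING D-0038), planner seat p1 g33: chapter ROUTE-P1AF addenda ADD4 ∕ ADD5 (memos `HOME/memos/ROUTE-P1AF-ADD4.md`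
b7ad80a65555c84d, `…-ADD5.md` ffaf9911041dfeba; referee PASS 0∕0: ref g52 REF-P1AF-ADD4.md 83f6fe06da4ed38e, ref g53 REF-P1AF-ADD5.md bcccb0bceb665800),
frozen Sketch `HOME/p1/route/Sketch_P1AF_RGENTWIN_g33.lean` (sha16 596f05bb769cab0c, 1805 lines, namespaces `HodgeNonAV.P1AF.GenTwin` + the line's
`…CancelByAnyClaimLattice.PairedNull ∕ .CoprimeSix`, farm rc 0 / 0 sorries / axioms {propext, Classical.choice, Quot.sound}; re-elaborated 2026-08-28), split into
nine tree modules `…GeneralTwinSplit` → `…GeneralTwinLocal` → `…GeneralTwinLevel` → `…GeneralTwinLevelOne` → `…GeneralTwinGlue` → `…FibreOfTopLevelGeneralTwinKey` → `…FibreOfTopLevelGeneralTwin` →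
`…FibreOfProgressionGeneralTwin` → `…GeneralTwinPayoff` by planner p1 g34 (landing kit HOME/p1/landing/); proof bodies verbatim (cell namespace renamed
`…Theorems.CancelByAnyClaimLattice.GenTwin`); docstrings reworded per referee rider N-ADD4-1 (Aoki 1983 cites are METHOD attributions; the statements without
the twin exclusion are not in print). Target: lead c4's `CoprimeSix.hodgeConjectureFor_general` (`Theorems/…GeneralPayoff`) WITHOUT the hypothesis
`htwin : ¬ p₁ (p₁+2) ∣ m` — replaced by `(p₁+2)² ∤ m`. Land with `--supports stmt-HodgeConjecture-1334` (line `cancel-by-any-claim-lattice` of crux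
`HodgeFermatVarieties`, route `PadicSemiregularLift`). No instance, no new notation (the `local notation3` of Parts 2, 3 and 9 are the line's, verbatim from
`Theorems/PadicSemiregularLiftHodgeFermatVarietiesFibreOfBoundaryPow` ∕ `…GeneralPayoff`), no sorry, no new axiom.
HONEST SCOPE: the HC pay-off `hodgeConjectureFor_general₂` is MODULO the line's named facts (S0) and stub statements (S2↑, S2↓, S3a, S5), exactly as c4's
`hodgeConjectureFor_general`; Fermat varieties are dominated by abelian motives (inside the known AV region); NOTHING here proves the Hodge conjecture.
References (method): N. Aoki, Math. Ann. 266 (1983) Thm A′ (§7), Prop. 2.2, Prop. 6.4, §9 [cite: Aoki1983, Thm. A]; N. Aoki, J. Math. Soc. Japan 39 (1987)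
Thm 1-1, Thm 2-1 [cite: Aoki1987, Thm. 2-1]; T. Shioda, Proc. Japan Acad. 55 (1979) §2 Thm 1 [cite: Shioda1979PJA, Thm. 1].
-/

set_option linter.dupNamespace false

noncomputable section

namespace Summit.HodgeConjecture.HodgeConjecture.Theorems.CancelByAnyClaimLattice.GenTwin

open Finset
open Literature.AlgebraicGeometry.HodgeTheory Literature.AlgebraicGeometry.HodgeTheory.FermatCharacter
open Summit.HodgeConjecture.HodgeConjecture.Theorems.CancelByAnyClaimLattice
open Summit.HodgeConjecture.HodgeConjecture.Theorems.CancelByAnyClaimLattice.PairedNull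
open Summit.HodgeConjecture.HodgeConjecture.Theorems.CancelByAnyClaimLattice.FiveQ.FourierSplit

section LevelOne

open Summit.HodgeConjecture.HodgeConjecture.Theorems.CancelByAnyClaimLattice.PQ
open Summit.HodgeConjecture.HodgeConjecture.Theorems.CancelByAnyClaimLattice.FiveQ
open Summit.HodgeConjecture.HodgeConjecture.Theorems.CancelByAnyClaimLattice.PQTwin

variable {p q : ℕ} [Fact p.Prime] [Fact q.Prime]

/-- **(L-twin) at level exactly `p r` (`n = 1`).** Let `5 ≤ p < r`, `11 ≤ r` be primes and `T : ℤ/(p r) → ℂ`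
`{0,1}`-valued, vanishing off the units, annihilated by every odd primitive character mod `p r`, with
`#supp T ≤ p + 1`. Then `T` is even, or a full `r`-fibre `{a unit : a ≡ u₀ (mod p)}` lies in `supp T`, or a full
`p`-fibre `{a unit : a ≡ y₀ (mod r)}` lies in `supp T`. (Here `E = T - T∘neg` is odd and orthogonal to ALL primitive
characters; parity-free split + odd symmetrisation + ADD2's `false_of_both_ne_zero`.)
(method after (method after [cite: Aoki1983, Thm. A′ (§7)]); statement new — cell hodge-nonav P1 g33, memos ROUTE-P1AF-ADD2 ∕ ADD4 — not in print) -/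
theorem even_or_fibre_twoPrime_one (hp5 : 5 ≤ p) (hpq : p < q) (hq11 : 11 ≤ q) (hprc : p.Coprime q)
    (T : ZMod (p * q) → ℂ) (h01 : ∀ z, T z = 0 ∨ T z = 1) (hTu : ∀ z, ¬ IsUnit z → T z = 0)
    (hT : ∀ χ : DirichletCharacter ℂ (p * q), χ.Odd → χ.IsPrimitive → ∑ z : ZMod (p * q), T z * χ z = 0)
    (hsuppT : #(univ.filter fun z : ZMod (p * q) ↦ T z ≠ 0) ≤ p + 1) :
    (∀ z, T (-z) = T z) ∨
    (∃ u₀ : (ZMod p)ˣ, ∀ a : ZMod (p * q), IsUnit a →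
        ZMod.castHom (dvd_mul_right p q) (ZMod p) a = u₀ → T a ≠ 0) ∨
    (∃ y₀ : (ZMod q)ˣ, ∀ a : ZMod (p * q), IsUnit a →
        ZMod.castHom (dvd_mul_left q p) (ZMod q) a = y₀ → T a ≠ 0) := by
  classical
  have hpP : p.Prime := Fact.out
  have hqP : q.Prime := Fact.out
  have hpq' : p ≠ q := hpq.ne
  -- `E = T - T∘neg` is orthogonal to every `χ₁ ⊠ χ₂` with both components non-trivial
  set E : ZMod (p * q) → ℂ := fun a ↦ T a - T (-a) with hE
  have hEodd : ∀ a, E (-a) = -E a := fun a ↦ by simp only [hE, neg_neg]; ring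
  have hEorth' : ∀ (ψ₁ : DirichletCharacter ℂ p) (ψ₂ : DirichletCharacter ℂ q), ψ₁ ≠ 1 → ψ₂ ≠ 1 →
      ∑ a : ZMod (p * q), E a * (DirichletCharacter.changeLevel (dvd_mul_right p q) ψ₁ *
        DirichletCharacter.changeLevel (dvd_mul_left q p) ψ₂) a = 0 := by
    intro ψ₁ ψ₂ h₁ h₂
    set χ := DirichletCharacter.changeLevel (dvd_mul_right p q) ψ₁ *
      DirichletCharacter.changeLevel (dvd_mul_left q p) ψ₂ with hχ
    have hprim : χ.IsPrimitive := prodChar_isPrimitive hprc (isPrimitive_of_ne_one h₁) (isPrimitive_of_ne_one h₂)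
    have hsplit : ∑ a : ZMod (p * q), E a * χ a =
        ∑ a : ZMod (p * q), T a * χ a - ∑ a : ZMod (p * q), T (-a) * χ a := by
      rw [← Finset.sum_sub_distrib]
      exact Finset.sum_congr rfl fun a _ ↦ by simp only [hE]; ring
    have hrefl : ∑ a : ZMod (p * q), T (-a) * χ a = χ (-1) * ∑ a : ZMod (p * q), T a * χ a := by
      rw [Finset.mul_sum, ← Equiv.sum_comp (Equiv.neg (ZMod (p * q)))]
      refine Finset.sum_congr rfl fun a _ ↦ ?_
      rw [Equiv.neg_apply, neg_neg, show χ (-a) = χ (-1) * χ a by rw [← map_mul, neg_one_mul]]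
      ring
    rw [hsplit, hrefl]
    rcases char_neg_one_eq_or χ with hev | hodd
    · rw [hev]; ring
    · rw [hT χ hodd hprim]; ring
  obtain ⟨G, H, hGH⟩ := split_of_orthogonal_all p q hprc E hEorth'
  -- odd symmetrisation
  set G' : (ZMod q)ˣ → ℂ := fun b ↦ (G b - G (-b)) / 2 with hG'
  set H' : (ZMod p)ˣ → ℂ := fun a ↦ (H a - H (-a)) / 2 with hH'
  have hG'odd : ∀ b, G' (-b) = -G' b := fun b ↦ by simp only [hG', neg_neg]; ring
  have hH'odd : ∀ a, H' (-a) = -H' a := fun a ↦ by simp only [hH', neg_neg]; ring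
  have hGH' : ∀ x : (ZMod (p * q))ˣ, E x = G' (ZMod.unitsMap (dvd_mul_left q p) x) +
      H' (ZMod.unitsMap (dvd_mul_right p q) x) := by
    intro x
    have h1 := hGH x
    have h2 := hGH (-x)
    rw [Units.val_neg, hEodd, FiveQ.unitsMap_neg, FiveQ.unitsMap_neg] at h2
    simp only [hG', hH']
    linear_combination (1 / 2 : ℂ) * h1 - (1 / 2 : ℂ) * h2
  -- the multiset of the support, to feed ADD2's counting lemma
  set s : Multiset (ZMod (p * q)) := (univ.filter fun z : ZMod (p * q) ↦ T z ≠ 0).val with hs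
  have hcount : ∀ z, (Multiset.count z s : ℂ) = T z := by
    intro z
    rw [hs, Multiset.count_eq_of_nodup (Finset.nodup _)]
    by_cases hz : T z ≠ 0
    · rw [if_pos (by simpa using hz)]
      rcases h01 z with h | h
      · exact absurd h hz
      · rw [h, Nat.cast_one]
    · rw [if_neg (by simpa using hz), not_not.mp hz, Nat.cast_zero]
  have hA : Multiset.card (s.filter IsUnit) ≤ p + 1 :=
    (Multiset.card_le_card (Multiset.filter_le _ _)).trans (by rw [hs, Finset.card_val]; exact hsuppT)
  have ho : ∀ x : (ZMod (p * q))ˣ, (Multiset.count (x : ZMod (p * q)) s : ℂ) -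
      Multiset.count (-(x : ZMod (p * q))) s =
      G' (ZMod.unitsMap (dvd_mul_left q p) x) + H' (ZMod.unitsMap (dvd_mul_right p q) x) := by
    intro x; rw [hcount, hcount, ← hGH' x]
  -- CRT coordinates
  choose ℓ hℓ₁ hℓ₂ using fun (u : (ZMod p)ˣ) (y : (ZMod q)ˣ) ↦ exists_unit_crt hprc u y
  have hM : ∀ u y, E (ℓ u y) = G' y + H' u := fun u y ↦ by rw [hGH', hℓ₁, hℓ₂]
  have hcoordp : ∀ u y, ZMod.castHom (dvd_mul_right p q) (ZMod p) ((ℓ u y : (ZMod (p * q))ˣ) : ZMod (p * q)) = u := by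
    intro u y
    have := congrArg Units.val (hℓ₁ u y)
    simpa [ZMod.unitsMap_def] using this
  have hcoordr : ∀ u y, ZMod.castHom (dvd_mul_left q p) (ZMod q) ((ℓ u y : (ZMod (p * q))ˣ) : ZMod (p * q)) = y := by
    intro u y
    have := congrArg Units.val (hℓ₂ u y)
    simpa [ZMod.unitsMap_def] using this
  have hinj : ∀ a a' : ZMod (p * q), ZMod.castHom (dvd_mul_right p q) (ZMod p) a = ZMod.castHom (dvd_mul_right p q) (ZMod p) a' →
      ZMod.castHom (dvd_mul_left q p) (ZMod q) a = ZMod.castHom (dvd_mul_left q p) (ZMod q) a' → a = a' := by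
    intro a a' h1 h2
    rw [← crt_symm_castHom hprc a, ← crt_symm_castHom hprc a', h1, h2]
  have hliftp : ∀ (u : (ZMod p)ˣ) (a : ZMod (p * q)), IsUnit a →
      ZMod.castHom (dvd_mul_right p q) (ZMod p) a = u → ∃ y, a = ℓ u y := by
    intro u a ha hpa
    refine ⟨ZMod.unitsMap (dvd_mul_left q p) ha.unit, hinj _ _ (by rw [hcoordp, hpa]) ?_⟩
    rw [hcoordr]
    simp [ZMod.unitsMap_def]
  have hliftr : ∀ (y : (ZMod q)ˣ) (a : ZMod (p * q)), IsUnit a →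
      ZMod.castHom (dvd_mul_left q p) (ZMod q) a = y → ∃ u, a = ℓ u y := by
    intro y a ha hra
    refine ⟨ZMod.unitsMap (dvd_mul_right p q) ha.unit, hinj _ _ ?_ (by rw [hcoordr, hra])⟩
    rw [hcoordp]
    simp [ZMod.unitsMap_def]
  -- values of `E`
  have hE01 : ∀ a, E a = 0 ∨ E a = 1 ∨ E a = -1 := by
    intro a
    simp only [hE]
    rcases h01 a with h | h <;> rcases h01 (-a) with h' | h' <;> simp only [h, h'] <;> norm_num
  have hval1 : ∀ a, E a = 1 → T a ≠ 0 := by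
    intro a ha h0
    simp only [hE, h0, zero_sub] at ha
    rcases h01 (-a) with h' | h' <;> rw [h'] at ha <;> norm_num at ha
  have hvalm1 : ∀ a, E a = -1 → T (-a) ≠ 0 := by
    intro a ha h0
    simp only [hE, h0, sub_zero] at ha
    rcases h01 a with h' | h' <;> rw [h'] at ha <;> norm_num at ha
  -- ROW / COLUMN conclusions from a constant non-zero row / column of `E`
  have rowOf : ∀ (u : (ZMod p)ˣ) (c : ℂ), c ≠ 0 → (∀ y, E (ℓ u y) = c) →
      ∃ u₀ : (ZMod p)ˣ, ∀ a : ZMod (p * q), IsUnit a →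
        ZMod.castHom (dvd_mul_right p q) (ZMod p) a = u₀ → T a ≠ 0 := by
    intro u c hc0 hrow
    have hc1 : c = 1 ∨ c = -1 := by
      rcases hE01 (ℓ u 1) with h | h | h
      · exact absurd (by rw [← hrow 1, h]) hc0
      · exact Or.inl (by rw [← hrow 1, h])
      · exact Or.inr (by rw [← hrow 1, h])
    rcases hc1 with rfl | rfl
    · refine ⟨u, fun a ha hpa ↦ hval1 a ?_⟩
      obtain ⟨y, rfl⟩ := hliftp u a ha hpa
      exact hrow y
    · refine ⟨-u, fun a ha hpa ↦ ?_⟩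
      have hna : ZMod.castHom (dvd_mul_right p q) (ZMod p) (-a) = u := by
        rw [map_neg, hpa, Units.val_neg, neg_neg]
      obtain ⟨y, hy⟩ := hliftp u (-a) ha.neg hna
      have := hvalm1 (-a) (by rw [hy]; exact hrow y)
      rwa [neg_neg] at this
  have colOf : ∀ (y : (ZMod q)ˣ) (c : ℂ), c ≠ 0 → (∀ u, E (ℓ u y) = c) →
      ∃ y₀ : (ZMod q)ˣ, ∀ a : ZMod (p * q), IsUnit a →
        ZMod.castHom (dvd_mul_left q p) (ZMod q) a = y₀ → T a ≠ 0 := by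
    intro y c hc0 hcol
    have hc1 : c = 1 ∨ c = -1 := by
      rcases hE01 (ℓ 1 y) with h | h | h
      · exact absurd (by rw [← hcol 1, h]) hc0
      · exact Or.inl (by rw [← hcol 1, h])
      · exact Or.inr (by rw [← hcol 1, h])
    rcases hc1 with rfl | rfl
    · refine ⟨y, fun a ha hra ↦ hval1 a ?_⟩
      obtain ⟨u, rfl⟩ := hliftr y a ha hra
      exact hcol u
    · refine ⟨-y, fun a ha hra ↦ ?_⟩
      have hna : ZMod.castHom (dvd_mul_left q p) (ZMod q) (-a) = y := by
        rw [map_neg, hra, Units.val_neg, neg_neg]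
      obtain ⟨u, hu⟩ := hliftr y (-a) ha.neg hna
      have := hvalm1 (-a) (by rw [hu]; exact hcol u)
      rwa [neg_neg] at this
  by_cases hH0 : ∃ a, H' a ≠ 0
  · by_cases hG0 : ∃ b, G' b ≠ 0
    · exact (false_of_both_ne_zero hp5 hpq hq11 hA hG'odd hH'odd ho hG0 hH0).elim
    · -- `G' ≡ 0`: the row of `u` is constant `= H' u ≠ 0`
      push Not at hG0
      obtain ⟨u, hu⟩ := hH0
      exact Or.inr (Or.inl (rowOf u (H' u) hu (fun y ↦ by rw [hM, hG0, zero_add])))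
  · push Not at hH0
    by_cases hG0 : ∃ b, G' b ≠ 0
    · -- `H' ≡ 0`: the column of `y` is constant `= G' y ≠ 0`
      obtain ⟨y, hy⟩ := hG0
      exact Or.inr (Or.inr (colOf y (G' y) hy (fun u ↦ by rw [hM, hH0, add_zero])))
    · -- both zero: `T` is even
      push Not at hG0
      left
      intro z
      by_cases hz : IsUnit z
      · have h := hGH' hz.unit
        rw [hG0, hH0, add_zero, IsUnit.unit_spec] at h
        simp only [hE] at h
        exact (sub_eq_zero.mp h).symm
      · rw [hTu z hz, hTu (-z) (fun h ↦ hz (by simpa using h.neg))]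

end LevelOne

end Summit.HodgeConjecture.HodgeConjecture.Theorems.CancelByAnyClaimLattice.GenTwin

end
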